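import Literature.Geometry.Lorentzian.CoordCurvatureLaplacian
import Mathlib.LinearAlgebra.QuadraticForm.Basic
import Mathlib.Analysis.SpecialFunctions.Pow.Real
import HarnessLib

/-!
# The square norm of the curvature tensor in coordinates and its frame estimates

Static algebra for Topping's curvature doubling estimate (Topping 2006, Prop. 3.2.10 and
Thm. 3.2.11): for metric components `G : E → (E →L E →L ℝ)` (`CoordCurvature.lean` ff.) we
define the **square norm of the curvature tensor**

  `rmNormSqAt G x = |Rm|²_G (x) = −tr_G tr_G tr(R(X,Y) ∘ R(X',Y'))`
  `= −Σ g^{aa'} g^{cc'} tr(R(b_a,b_c) R(b_{a'},b_{c'}))` (`rmNormSqAt_eq_sum`, any basis)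
  `= Σ_{acij} G(R(e_a,e_c)e_i, e_j)²` (`rmNormSqAt_eq_sum_sq`, `G_x`-orthonormal basis `e`),

i.e. Topping's `|Rm|² = g^{ij}g^{kl}g^{ab}g^{cd} R_{ikac}R_{jlbd}` ((3.2.4), p. 37; the sign because
`R(X,Y)` is `G`-skew), basis-free through the metric trace `mtrAt`, and prove the pointwise
linear algebra used with it:

* `exists_orthonormal_basis` — a positive definite `G x` has an orthonormal basis
  (Mathlib's `LinearMap.BilinForm.exists_orthogonal_basis`, normalised); `ginv`, coordinates,
  traces and compositions in such a basis;
* component bounds ("`Rm * Rm * Rm ≤ C |Rm|³`"): compositions, traces, slot expansions and Ricci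
  contractions of endomorphisms whose components are bounded (`abs_apply_comp_le`,
  `abs_traceCLM_le`, `abs_apply_riem_left_le`, …), the elementary estimates behind the constant
  `C(n)` of Prop. 3.2.10;
* `rmNormSqAt_nonneg`, `abs_rm_le_sqrt` (`|R_{acij}| ≤ |Rm|`), and the **frame comparison** with
  the tree's `CurvatureBoundedBy` (frame form of `|Rm| ≤ K`, `RicciFlowMaximal.lean`):
  `rmNormSqAt_le_of_frameBound` (`|Rm|² ≤ n⁴ K²`) and `abs_apply_riem_le_sqrt_rmNormSqAt`
  (`|G(R(X,Y)Z,W)| ≤ |Rm|` on `G`-unit-bounded vectors, Cauchy–Schwarz) — Topping 2006, p. 37: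
  "`|Rm|` is comparable to the norm of the largest sectional curvature".

Everything is proved; the definitions introduced (`trCompCLM`, `rmPair`, `rmInner`,
`rmNormSqAt`) are explicit.

## References

* P. Topping, *Lectures on the Ricci flow*, LMS Lecture Note Series 325, CUP 2006, §2.1 (norms
  of tensors), §3.2, Prop. 3.2.10 and its proof, (3.2.4) (p. 37). [Topping2006]
* B. O'Neill, *Semi-Riemannian geometry with applications to relativity*, Academic Press 1983,
  Ch. 2, Lemma 2.24 ff. (orthonormal bases), Ch. 3, pp. 60–61 (metric contraction). [ONeill1983]
-/

noncomputable section

set_option maxSynthPendingDepth 3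

open Set Filter ContinuousLinearMap Module
open scoped Topology ContDiff

namespace Literature.Geometry.Lorentzian

namespace MetricCoord

variable {E : Type*} [NormedAddCommGroup E] [NormedSpace ℝ E]

/-! ### The square norm of the curvature tensor -/

section NormSq

variable [FiniteDimensional ℝ E]

variable (E) in
/-- The trace pairing of endomorphisms `(A, B) ↦ tr(A ∘ B)` as a continuous bilinear map.
[folklore] -/
def trCompCLM : (E →L[ℝ] E) →L[ℝ] (E →L[ℝ] E) →L[ℝ] ℝ :=
  (ContinuousLinearMap.compL ℝ (E →L[ℝ] E) (E →L[ℝ] E) ℝ (traceCLM E)).comp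
    (ContinuousLinearMap.compL ℝ E E E)

/-- Unfolding lemma: `trCompCLM E A B = tr(A ∘ B)`. [folklore] -/
@[simp]
theorem trCompCLM_apply (A B : E →L[ℝ] E) : trCompCLM E A B = traceCLM E (A.comp B) := rfl

variable (G : E → E →L[ℝ] E →L[ℝ] ℝ)

/-- `rmPair G x X X' (Y, Y') = tr(R(X,Y) ∘ R(X',Y'))`, a bilinear form in `(Y, Y')`. [folklore] -/
def rmPair (x X X' : E) : E →L[ℝ] E →L[ℝ] ℝ :=
  (trCompCLM E).bilinearComp (riemCLM G x X) (riemCLM G x X')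

/-- Unfolding lemma for `rmPair`. [folklore] -/
@[simp]
theorem rmPair_apply (x X X' Y Y' : E) :
    rmPair G x X X' Y Y' = traceCLM E ((riemAt G x X Y).comp (riemAt G x X' Y')) := by
  simp [rmPair]

/-- `rmPair` is additive in `X`. [folklore] -/
theorem rmPair_add_left (x X₁ X₂ X' : E) :
    rmPair G x (X₁ + X₂) X' = rmPair G x X₁ X' + rmPair G x X₂ X' := by
  simp only [rmPair, map_add]
  ext Y Y'
  simp [ContinuousLinearMap.bilinearComp_apply]

/-- `rmPair` is homogeneous in `X`. [folklore] -/
theorem rmPair_smul_left (x : E) (c : ℝ) (X X' : E) :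
    rmPair G x (c • X) X' = c • rmPair G x X X' := by
  simp only [rmPair, map_smul]
  ext Y Y'
  simp [ContinuousLinearMap.bilinearComp_apply]

/-- `rmPair` is additive in `X'`. [folklore] -/
theorem rmPair_add_right (x X X₁ X₂ : E) :
    rmPair G x X (X₁ + X₂) = rmPair G x X X₁ + rmPair G x X X₂ := by
  simp only [rmPair, map_add]
  ext Y Y'
  simp [ContinuousLinearMap.bilinearComp_apply]

/-- `rmPair` is homogeneous in `X'`. [folklore] -/
theorem rmPair_smul_right (x : E) (c : ℝ) (X X' : E) :
    rmPair G x X (c • X') = c • rmPair G x X X' := by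
  simp only [rmPair, map_smul]
  ext Y Y'
  simp [ContinuousLinearMap.bilinearComp_apply]

/-- `rmInner G x (X, X') = tr_G [(Y,Y') ↦ tr(R(X,Y) ∘ R(X',Y'))] = Σ g^{cc'} tr(R(X,b_c)R(X',b_{c'}))`,
a bilinear form in `(X, X')`. [folklore] -/
def rmInner (x : E) : E →L[ℝ] E →L[ℝ] ℝ :=
  mkCLM₂ (fun X X' ↦ mtrAt G x (rmPair G x X X'))
    (fun X₁ X₂ X' ↦ by rw [rmPair_add_left, mtrAt_add])
    (fun c X X' ↦ by rw [rmPair_smul_left, mtrAt_smul])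
    (fun X X₁ X₂ ↦ by rw [rmPair_add_right, mtrAt_add])
    (fun c X X' ↦ by rw [rmPair_smul_right, mtrAt_smul])

/-- Unfolding lemma for `rmInner`. [folklore] -/
@[simp]
theorem rmInner_apply (x X X' : E) : rmInner G x X X' = mtrAt G x (rmPair G x X X') := rfl

/-- The **square norm of the curvature tensor** of the components at `x`:
`|Rm|²_G = −tr_G tr_G tr(R(X,Y) ∘ R(X',Y'))` (contracting `X` with `X'` and `Y` with `Y'`), which is
Topping's `|Rm|² = g^{ij}g^{kl}g^{ab}g^{cd}R_{ikac}R_{jlbd}` (2006, (3.2.4), proof of Prop. 3.2.10;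
§2.1, the norm induced on tensors): lowering the two endomorphism slots,
`Σ g^{cc'}g^{dd'} G(R(X,Y)b_c,b_d) G(R(X',Y')b_{c'},b_{d'}) = −tr(R(X,Y) R(X',Y'))` because `R(X,Y)`
is `G`-skew-adjoint (`rmNormSqAt_eq_sum_sq`). [cite: Topping2006, §3.2, (3.2.4)] -/
def rmNormSqAt (x : E) : ℝ :=
  -mtrAt G x (rmInner G x)

variable {ι : Type*} [Fintype ι] (b : Basis ι ℝ E) {G} {x : E}

/-- **`|Rm|²` in a basis**: `|Rm|²_G = −Σ_{aa'cc'} g^{aa'} g^{cc'} tr(R(b_a,b_c) ∘ R(b_{a'},b_{c'}))`.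
[cite: Topping2006, §3.2, (3.2.4)] -/
theorem rmNormSqAt_eq_sum : rmNormSqAt G x =
    -∑ a, ∑ a', ∑ c, ∑ c', ginv G b x a a' * ginv G b x c c' *
      traceCLM E ((riemAt G x (b a) (b c)).comp (riemAt G x (b a') (b c'))) := by
  rw [rmNormSqAt, mtrAt_eq_sum b]
  simp only [rmInner_apply, mtrAt_eq_sum b, rmPair_apply, Finset.mul_sum]
  congr 1
  refine Finset.sum_congr rfl fun a _ ↦ Finset.sum_congr rfl fun a' _ ↦
    Finset.sum_congr rfl fun c _ ↦ Finset.sum_congr rfl fun c' _ ↦ ?_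
  ring

variable {V : Set E} [CompleteSpace E]

/-- **`|Rm|²_G` is smooth on `V`** (a polynomial in `g⁻¹` and the components of `R`). [folklore] -/
theorem IsMetricOn.contDiffOn_rmNormSqAt (hG : IsMetricOn G V) : ContDiffOn ℝ ∞ (rmNormSqAt G) V := by
  set b₀ := Module.finBasis ℝ E
  have heq : rmNormSqAt G = fun y ↦ -∑ a, ∑ a', ∑ c, ∑ c', ginv G b₀ y a a' * ginv G b₀ y c c' *
      traceCLM E ((riemAt G y (b₀ a) (b₀ c)).comp (riemAt G y (b₀ a') (b₀ c'))) :=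
    funext fun y ↦ rmNormSqAt_eq_sum b₀
  rw [heq]
  refine ContDiffOn.neg (ContDiffOn.sum fun a _ ↦ ContDiffOn.sum fun a' _ ↦
    ContDiffOn.sum fun c _ ↦ ContDiffOn.sum fun c' _ ↦ ?_)
  exact ((hG.contDiffOn_ginv b₀ a a').mul (hG.contDiffOn_ginv b₀ c c')).mul
    ((traceCLM E).contDiff.comp_contDiffOn
      ((hG.contDiffOn_riemAt (b₀ a) (b₀ c)).clm_comp (hG.contDiffOn_riemAt (b₀ a') (b₀ c'))))

end NormSq

/-! ### Orthonormal bases of a positive definite form -/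

section Orthonormal

variable {ι : Type*} [Fintype ι] [DecidableEq ι] [FiniteDimensional ℝ E]
  {G : E → E →L[ℝ] E →L[ℝ] ℝ} {x : E}

omit [Fintype ι] [DecidableEq ι] in
/-- **A symmetric positive definite form has an orthonormal basis** (O'Neill 1983, Ch. 2,
Lemma 2.24 ff.; Mathlib's `LinearMap.BilinForm.exists_orthogonal_basis`, normalised using
positivity). [cite: ONeill1983, Ch. 2, Lemma 2.24] -/
theorem exists_orthonormal_basis (hs : ∀ v w, G x v w = G x w v) (hpos : ∀ v, v ≠ 0 → 0 < G x v v) :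
    ∃ e : Basis (Fin (finrank ℝ E)) ℝ E, ∀ i j, G x (e i) (e j) = if i = j then 1 else 0 := by
  classical
  set B : LinearMap.BilinForm ℝ E := LinearMap.mk₂ ℝ (fun v w ↦ G x v w)
    (fun v₁ v₂ w ↦ by rw [map_add, _root_.add_apply]) (fun c v w ↦ by rw [map_smul, _root_.smul_apply, smul_eq_mul])
    (fun v w₁ w₂ ↦ by rw [map_add]) (fun c v w ↦ by rw [map_smul, smul_eq_mul]) with hB
  have hBa : ∀ v w, B v w = G x v w := fun v w ↦ rfl
  have hsymm : LinearMap.IsSymm B :=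
    LinearMap.isSymm_def.mpr fun v w ↦ by rw [RingHom.id_apply, hBa, hBa, hs]
  obtain ⟨v, hv⟩ := LinearMap.BilinForm.exists_orthogonal_basis hsymm
  have hvpos : ∀ i, 0 < G x (v i) (v i) := fun i ↦ hpos _ (v.ne_zero i)
  set w : Fin (finrank ℝ E) → ℝ := fun i ↦ (Real.sqrt (G x (v i) (v i)))⁻¹ with hw
  have hwpos : ∀ i, 0 < w i := fun i ↦ inv_pos.mpr (Real.sqrt_pos.mpr (hvpos i))
  have hwu : ∀ i, IsUnit (w i) := fun i ↦ (hwpos i).ne'.isUnit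
  refine ⟨v.isUnitSMul hwu, fun i j ↦ ?_⟩
  simp only [Basis.isUnitSMul_apply, map_smul, _root_.smul_apply, smul_eq_mul]
  by_cases hij : i = j
  · subst hij
    simp only [if_true, hw]
    have h := hvpos i
    have hsq : Real.sqrt (G x (v i) (v i)) ^ 2 = G x (v i) (v i) := Real.sq_sqrt h.le
    field_simp
    linarith [hsq]
  · simp only [hij, if_false]
    have h0 : G x (v i) (v j) = 0 := by rw [← hBa]; exact hv hij
    rw [h0, mul_zero, mul_zero]

variable (e : Basis ι ℝ E) (he : ∀ i j, G x (e i) (e j) = if i = j then 1 else 0)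
include he

omit [FiniteDimensional ℝ E] in
/-- In an orthonormal basis the dual basis is `eⁱ = G(·, e_i)`. [cite: ONeill1983, Ch. 2, Lemma 2.25] -/
theorem coord_eq_apply_of_orthonormal (v : E) (i : ι) : e.coord i v = G x v (e i) := by
  classical
  conv_rhs => rw [← e.sum_repr v]
  rw [map_sum, _root_.sum_apply]
  simp only [map_smul, _root_.smul_apply, smul_eq_mul, he, mul_ite, mul_one, mul_zero,
    Finset.sum_ite_eq', Finset.mem_univ, if_true, Basis.coord_apply]

omit [FiniteDimensional ℝ E] in
/-- **Expansion in an orthonormal basis**: `v = Σ_i G(v, e_i) e_i`. [cite: ONeill1983, Ch. 2, Lemma 2.25] -/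
theorem sum_apply_smul_of_orthonormal (v : E) : ∑ i, G x v (e i) • e i = v := by
  conv_rhs => rw [← e.sum_repr v]
  exact Finset.sum_congr rfl fun i _ ↦ by rw [← coord_eq_apply_of_orthonormal e he, Basis.coord_apply]

/-- In an orthonormal basis `g^{ij} = δ^{ij}`. [cite: ONeill1983, Ch. 3, p. 60] -/
theorem ginv_of_orthonormal (hx : (G x).IsInvertible) (i j : ι) :
    ginv G e x i j = if i = j then 1 else 0 := by
  classical
  have h := coord_eq_sum_ginv e hx (e j) i
  simp only [he, mul_ite, mul_one, mul_zero, Finset.sum_ite_eq, Finset.mem_univ, if_true] at h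
  rw [← h, Basis.coord_apply, e.repr_self, Finsupp.single_apply]
  simp only [eq_comm]

/-- **The trace in an orthonormal basis**: `tr A = Σ_i G(A e_i, e_i)`. [cite: ONeill1983, Ch. 3, p. 60] -/
theorem traceCLM_eq_sum_of_orthonormal (A : E →L[ℝ] E) :
    traceCLM E A = ∑ i, G x (A (e i)) (e i) := by
  rw [traceCLM_apply, trace_eq_sum_coord e]
  exact Finset.sum_congr rfl fun i _ ↦ by
    rw [ContinuousLinearMap.coe_coe, coord_eq_apply_of_orthonormal e he]

omit [FiniteDimensional ℝ E] in
/-- **Composition in an orthonormal basis**: `G(A B e_i, e_j) = Σ_m G(B e_i, e_m) G(A e_m, e_j)`.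
[cite: ONeill1983, Ch. 3, p. 60] -/
theorem apply_comp_of_orthonormal (A B : E →L[ℝ] E) (i j : ι) :
    G x (A (B (e i))) (e j) = ∑ m, G x (B (e i)) (e m) * G x (A (e m)) (e j) := by
  conv_lhs => rw [← sum_apply_smul_of_orthonormal e he (B (e i))]
  rw [map_sum, map_sum, _root_.sum_apply]
  exact Finset.sum_congr rfl fun m _ ↦ by
    rw [map_smul, map_smul, _root_.smul_apply, smul_eq_mul]

omit [FiniteDimensional ℝ E] in
/-- **Parseval in an orthonormal basis**: `G(v, w) = Σ_i G(v, e_i) G(w, e_i)`. [cite: ONeill1983, Ch. 2, Lemma 2.25] -/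
theorem apply_eq_sum_of_orthonormal (hs : ∀ v w, G x v w = G x w v) (v w : E) :
    G x v w = ∑ i, G x v (e i) * G x w (e i) := by
  conv_lhs => rw [← sum_apply_smul_of_orthonormal e he w]
  rw [map_sum]
  exact Finset.sum_congr rfl fun i _ ↦ by rw [map_smul, smul_eq_mul, hs v (e i), mul_comm]

end Orthonormal

/-! ### Component bounds in an orthonormal basis -/

section Bounds

variable {ι : Type*} [Fintype ι] [DecidableEq ι] [FiniteDimensional ℝ E]
  {G : E → E →L[ℝ] E →L[ℝ] ℝ} {x : E}
  (e : Basis ι ℝ E) (he : ∀ i j, G x (e i) (e j) = if i = j then 1 else 0)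
include he

omit [FiniteDimensional ℝ E] in
/-- Components of a composition: if `|G(A e_i,e_j)| ≤ M` and `|G(B e_i,e_j)| ≤ M'` for all `i, j`,
then `|G(A B e_i, e_j)| ≤ n M' M`. [folklore] -/
theorem abs_apply_comp_le {A B : E →L[ℝ] E} {M M' : ℝ} (hA : ∀ i j, |G x (A (e i)) (e j)| ≤ M)
    (hB : ∀ i j, |G x (B (e i)) (e j)| ≤ M') (i j : ι) :
    |G x (A (B (e i))) (e j)| ≤ Fintype.card ι * (M' * M) := by
  rw [apply_comp_of_orthonormal e he]
  refine (Finset.abs_sum_le_sum_abs _ _).trans ?_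
  have hM : 0 ≤ M := (abs_nonneg _).trans (hA i j)
  calc ∑ m, |G x (B (e i)) (e m) * G x (A (e m)) (e j)|
      ≤ ∑ _m : ι, M' * M := Finset.sum_le_sum fun m _ ↦ by
        rw [abs_mul]; exact mul_le_mul (hB i m) (hA m j) (abs_nonneg _) ((abs_nonneg _).trans (hB i m))
    _ = Fintype.card ι * (M' * M) := by simp [Finset.sum_const, Finset.card_univ]

/-- Trace bound: if `|G(A e_i,e_j)| ≤ M` then `|tr A| ≤ n M`. [folklore] -/
theorem abs_traceCLM_le {A : E →L[ℝ] E} {M : ℝ} (hA : ∀ i j, |G x (A (e i)) (e j)| ≤ M) :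
    |traceCLM E A| ≤ Fintype.card ι * M := by
  rw [traceCLM_eq_sum_of_orthonormal e he]
  refine (Finset.abs_sum_le_sum_abs _ _).trans ?_
  calc ∑ i, |G x (A (e i)) (e i)| ≤ ∑ _i : ι, M := Finset.sum_le_sum fun i _ ↦ hA i i
    _ = Fintype.card ι * M := by simp [Finset.sum_const, Finset.card_univ]

omit [FiniteDimensional ℝ E] in
/-- Slot expansion, first slot: for a continuous trilinear `R` with `|G(R(e_a,e_c)e_i, e_j)| ≤ K`
and a vector `v` with `|G(v, e_p)| ≤ ν`, `|G(R(v, e_c)e_i, e_j)| ≤ n ν K`. [folklore] -/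
theorem abs_apply_riem_left_le {R : E →L[ℝ] E →L[ℝ] E →L[ℝ] E} {K ν : ℝ}
    (hR : ∀ a c i j, |G x (R (e a) (e c) (e i)) (e j)| ≤ K) {v : E} (hv : ∀ p, |G x v (e p)| ≤ ν)
    (c i j : ι) : |G x (R v (e c) (e i)) (e j)| ≤ Fintype.card ι * (ν * K) := by
  conv_lhs => rw [← sum_apply_smul_of_orthonormal e he v]
  simp only [map_sum, map_smul, _root_.sum_apply, _root_.smul_apply, smul_eq_mul]
  refine (Finset.abs_sum_le_sum_abs _ _).trans ?_
  calc ∑ p, |G x v (e p) * G x (R (e p) (e c) (e i)) (e j)|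
      ≤ ∑ _p : ι, ν * K := Finset.sum_le_sum fun p _ ↦ by
        rw [abs_mul]; exact mul_le_mul (hv p) (hR p c i j) (abs_nonneg _) ((abs_nonneg _).trans (hv p))
    _ = Fintype.card ι * (ν * K) := by simp [Finset.sum_const, Finset.card_univ]

omit [FiniteDimensional ℝ E] in
/-- Slot expansion, second slot: `|G(R(e_a, v)e_i, e_j)| ≤ n ν K`. [folklore] -/
theorem abs_apply_riem_right_le {R : E →L[ℝ] E →L[ℝ] E →L[ℝ] E} {K ν : ℝ}
    (hR : ∀ a c i j, |G x (R (e a) (e c) (e i)) (e j)| ≤ K) {v : E} (hv : ∀ p, |G x v (e p)| ≤ ν)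
    (a i j : ι) : |G x (R (e a) v (e i)) (e j)| ≤ Fintype.card ι * (ν * K) := by
  conv_lhs => rw [← sum_apply_smul_of_orthonormal e he v]
  simp only [map_sum, map_smul, _root_.sum_apply, _root_.smul_apply, smul_eq_mul]
  refine (Finset.abs_sum_le_sum_abs _ _).trans ?_
  calc ∑ p, |G x v (e p) * G x (R (e a) (e p) (e i)) (e j)|
      ≤ ∑ _p : ι, ν * K := Finset.sum_le_sum fun p _ ↦ by
        rw [abs_mul]; exact mul_le_mul (hv p) (hR a p i j) (abs_nonneg _) ((abs_nonneg _).trans (hv p))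
    _ = Fintype.card ι * (ν * K) := by simp [Finset.sum_const, Finset.card_univ]

omit [FiniteDimensional ℝ E] in
/-- Bilinear expansion: for a continuous bilinear form `β` with `|β(e_a, e_c)| ≤ L` and vectors
with `|G(v,e_p)| ≤ ν`, `|G(w,e_p)| ≤ μ`: `|β(v, w)| ≤ n² ν μ L`. [folklore] -/
theorem abs_bilin_le {β : E →L[ℝ] E →L[ℝ] ℝ} {L ν μ : ℝ} (hβ : ∀ a c, |β (e a) (e c)| ≤ L)
    {v w : E} (hv : ∀ p, |G x v (e p)| ≤ ν) (hw : ∀ p, |G x w (e p)| ≤ μ) :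
    |β v w| ≤ Fintype.card ι * (Fintype.card ι * (ν * (μ * L))) := by
  have h1 : ∀ p, |β (e p) w| ≤ Fintype.card ι * (μ * L) := fun p ↦ by
    conv_lhs => rw [← sum_apply_smul_of_orthonormal e he w]
    simp only [map_sum, map_smul, smul_eq_mul]
    refine (Finset.abs_sum_le_sum_abs _ _).trans ?_
    calc ∑ q, |G x w (e q) * β (e p) (e q)| ≤ ∑ _q : ι, μ * L := Finset.sum_le_sum fun q _ ↦ by
          rw [abs_mul]; exact mul_le_mul (hw q) (hβ p q) (abs_nonneg _) ((abs_nonneg _).trans (hw q))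
      _ = Fintype.card ι * (μ * L) := by simp [Finset.sum_const, Finset.card_univ]
  conv_lhs => rw [← sum_apply_smul_of_orthonormal e he v]
  simp only [map_sum, map_smul, _root_.sum_apply, _root_.smul_apply, smul_eq_mul]
  refine (Finset.abs_sum_le_sum_abs _ _).trans ?_
  calc ∑ p, |G x v (e p) * β (e p) w|
      ≤ ∑ _p : ι, ν * (Fintype.card ι * (μ * L)) := Finset.sum_le_sum fun p _ ↦ by
        rw [abs_mul]; exact mul_le_mul (hv p) (h1 p) (abs_nonneg _) ((abs_nonneg _).trans (hv p))
    _ = Fintype.card ι * (Fintype.card ι * (ν * (μ * L))) := by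
        simp only [Finset.sum_const, Finset.card_univ, nsmul_eq_mul]
        ring

end Bounds

/-! ### The curvature in an orthonormal basis: `|Rm|² = Σ R_{acij}²` and frame comparison -/

section Curvature

variable {ι : Type*} [Fintype ι] [DecidableEq ι] [FiniteDimensional ℝ E] [CompleteSpace E]
  {G : E → E →L[ℝ] E →L[ℝ] ℝ} {V : Set E} {x : E}
  (e : Basis ι ℝ E) (he : ∀ i j, G x (e i) (e j) = if i = j then 1 else 0)
include he

omit [CompleteSpace E] in
/-- `Σ_{a'} g^{aa'} F(a') = F(a)` in an orthonormal basis. [folklore] -/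
theorem sum_ginv_mul_of_orthonormal (hx : (G x).IsInvertible) (F : ι → ℝ) (a : ι) :
    ∑ a', ginv G e x a a' * F a' = F a := by
  simp only [ginv_of_orthonormal e he hx, ite_mul, one_mul, zero_mul, Finset.sum_ite_eq,
    Finset.mem_univ, if_true]

omit [CompleteSpace E] in
/-- **The Ricci form in an orthonormal basis**: `Ric(Y,Z) = Σ_i G(R(e_i,Y)Z, e_i)`.
[cite: ONeill1983, Ch. 3, Lemma 3.52] -/
theorem ricAt_eq_sum_of_orthonormal (Y Z : E) :
    ricAt G x Y Z = ∑ i, G x (riemAt G x (e i) Y Z) (e i) := by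
  classical
  rw [ricAt_eq_sum_coord e]
  exact Finset.sum_congr rfl fun i _ ↦ coord_eq_apply_of_orthonormal e he _ i

/-- **`|Rm|²` is a sum of squares in an orthonormal basis**:
`|Rm|²_G = Σ_{acij} G(R(e_a,e_c)e_i, e_j)²` (Topping's `|Rm|²` in an orthonormal frame; the
endomorphisms `R(e_a,e_c)` are `G`-skew, `tr(A²) = −Σ A_{ij}²`). [cite: Topping2006, §3.2, (3.2.4)] -/
theorem IsMetricOn.rmNormSqAt_eq_sum_sq (hG : IsMetricOn G V) (hx : x ∈ V) :
    rmNormSqAt G x = ∑ a, ∑ c, ∑ i, ∑ j, (G x (riemAt G x (e a) (e c) (e i)) (e j)) ^ 2 := by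
  have hi := hG.isInvertible x hx
  rw [rmNormSqAt_eq_sum e]
  have h1 : ∀ a, ∑ a', ∑ c, ∑ c', ginv G e x a a' * ginv G e x c c' *
      traceCLM E ((riemAt G x (e a) (e c)).comp (riemAt G x (e a') (e c'))) =
      ∑ c, traceCLM E ((riemAt G x (e a) (e c)).comp (riemAt G x (e a) (e c))) := by
    intro a
    calc ∑ a', ∑ c, ∑ c', ginv G e x a a' * ginv G e x c c' *
          traceCLM E ((riemAt G x (e a) (e c)).comp (riemAt G x (e a') (e c')))
        = ∑ a', ginv G e x a a' * ∑ c, ∑ c', ginv G e x c c' *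
            traceCLM E ((riemAt G x (e a) (e c)).comp (riemAt G x (e a') (e c'))) := by
          refine Finset.sum_congr rfl fun a' _ ↦ ?_
          rw [Finset.mul_sum]
          refine Finset.sum_congr rfl fun c _ ↦ ?_
          rw [Finset.mul_sum]
          exact Finset.sum_congr rfl fun c' _ ↦ by ring
      _ = ∑ c, ∑ c', ginv G e x c c' *
            traceCLM E ((riemAt G x (e a) (e c)).comp (riemAt G x (e a) (e c'))) :=
          sum_ginv_mul_of_orthonormal e he hi _ a
      _ = _ := Finset.sum_congr rfl fun c _ ↦ sum_ginv_mul_of_orthonormal e he hi _ c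
  simp only [h1]
  rw [← Finset.sum_neg_distrib]
  refine Finset.sum_congr rfl fun a _ ↦ ?_
  rw [← Finset.sum_neg_distrib]
  refine Finset.sum_congr rfl fun c _ ↦ ?_
  rw [traceCLM_eq_sum_of_orthonormal e he, ← Finset.sum_neg_distrib]
  refine Finset.sum_congr rfl fun i _ ↦ ?_
  rw [ContinuousLinearMap.comp_apply, apply_comp_of_orthonormal e he, ← Finset.sum_neg_distrib]
  refine Finset.sum_congr rfl fun j _ ↦ ?_
  rw [hG.apply_riemAt_swap hx (e a) (e c) (e i) (e j)]
  ring

omit [DecidableEq ι] he in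
/-- A single term of a fourfold sum of nonnegative reals is at most the sum. [folklore] -/
theorem single_le_sum₄ {f : ι → ι → ι → ι → ℝ} (hf : ∀ a c i j, 0 ≤ f a c i j) (a c i j : ι) :
    f a c i j ≤ ∑ a', ∑ c', ∑ i', ∑ j', f a' c' i' j' := by
  have h4 : f a c i j ≤ ∑ j', f a c i j' :=
    Finset.single_le_sum (f := fun j' ↦ f a c i j') (fun j' _ ↦ hf a c i j') (Finset.mem_univ j)
  have h3 : ∑ j', f a c i j' ≤ ∑ i', ∑ j', f a c i' j' :=
    Finset.single_le_sum (f := fun i' ↦ ∑ j', f a c i' j')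
      (fun i' _ ↦ Finset.sum_nonneg fun j' _ ↦ hf a c i' j') (Finset.mem_univ i)
  have h2 : ∑ i', ∑ j', f a c i' j' ≤ ∑ c', ∑ i', ∑ j', f a c' i' j' :=
    Finset.single_le_sum (f := fun c' ↦ ∑ i', ∑ j', f a c' i' j')
      (fun c' _ ↦ Finset.sum_nonneg fun i' _ ↦ Finset.sum_nonneg fun j' _ ↦ hf a c' i' j')
      (Finset.mem_univ c)
  have h1 : ∑ c', ∑ i', ∑ j', f a c' i' j' ≤ ∑ a', ∑ c', ∑ i', ∑ j', f a' c' i' j' :=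
    Finset.single_le_sum (f := fun a' ↦ ∑ c', ∑ i', ∑ j', f a' c' i' j')
      (fun a' _ ↦ Finset.sum_nonneg fun c' _ ↦ Finset.sum_nonneg fun i' _ ↦
        Finset.sum_nonneg fun j' _ ↦ hf a' c' i' j') (Finset.mem_univ a)
  exact h4.trans (h3.trans (h2.trans h1))

/-- **Every curvature component is bounded by `|Rm|`**: `|G(R(e_a,e_c)e_i, e_j)| ≤ √(|Rm|²_G)`
in an orthonormal basis. [cite: Topping2006, §3.2, p. 37] -/
theorem IsMetricOn.abs_rm_le_sqrt (hG : IsMetricOn G V) (hx : x ∈ V) (a c i j : ι) :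
    |G x (riemAt G x (e a) (e c) (e i)) (e j)| ≤ Real.sqrt (rmNormSqAt G x) := by
  refine Real.abs_le_sqrt ?_
  rw [hG.rmNormSqAt_eq_sum_sq e he hx]
  exact single_le_sum₄ (f := fun a c i j ↦ (G x (riemAt G x (e a) (e c) (e i)) (e j)) ^ 2)
    (fun _ _ _ _ ↦ sq_nonneg _) a c i j

/-- **`|Rm|²_G ≥ 0`** when `G x` has an orthonormal basis. [cite: Topping2006, §3.2, p. 37] -/
theorem IsMetricOn.rmNormSqAt_nonneg (hG : IsMetricOn G V) (hx : x ∈ V) : 0 ≤ rmNormSqAt G x := by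
  rw [hG.rmNormSqAt_eq_sum_sq e he hx]
  exact Finset.sum_nonneg fun _ _ ↦ Finset.sum_nonneg fun _ _ ↦ Finset.sum_nonneg fun _ _ ↦
    Finset.sum_nonneg fun _ _ ↦ sq_nonneg _

/-- **Frame bound ⇒ norm bound**: if `|G(R(X,Y)Z,W)| ≤ K` for all `G`-unit-bounded `X, Y, Z, W`
(the frame form `CurvatureBoundedBy` of the tree), then `|Rm|²_G ≤ n⁴ K²`.
[cite: Topping2006, §3.2, p. 37] -/
theorem IsMetricOn.rmNormSqAt_le_of_frameBound (hG : IsMetricOn G V) (hx : x ∈ V) {K : ℝ}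
    (hK : ∀ X Y Z W : E, G x X X ≤ 1 → G x Y Y ≤ 1 → G x Z Z ≤ 1 → G x W W ≤ 1 →
      |G x (riemAt G x X Y Z) W| ≤ K) :
    rmNormSqAt G x ≤ (Fintype.card ι : ℝ) ^ 4 * K ^ 2 := by
  rw [hG.rmNormSqAt_eq_sum_sq e he hx]
  have h1 : ∀ i, G x (e i) (e i) ≤ 1 := fun i ↦ by rw [he]; simp
  have hterm : ∀ a c i j, (G x (riemAt G x (e a) (e c) (e i)) (e j)) ^ 2 ≤ K ^ 2 := fun a c i j ↦ by
    have h := hK (e a) (e c) (e i) (e j) (h1 a) (h1 c) (h1 i) (h1 j)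
    rw [← sq_abs]
    exact pow_le_pow_left₀ (abs_nonneg _) h 2
  calc ∑ a, ∑ c, ∑ i, ∑ j, (G x (riemAt G x (e a) (e c) (e i)) (e j)) ^ 2
      ≤ ∑ _a : ι, ∑ _c : ι, ∑ _i : ι, ∑ _j : ι, K ^ 2 :=
        Finset.sum_le_sum fun a _ ↦ Finset.sum_le_sum fun c _ ↦ Finset.sum_le_sum fun i _ ↦
          Finset.sum_le_sum fun j _ ↦ hterm a c i j
    _ = (Fintype.card ι : ℝ) ^ 4 * K ^ 2 := by
        simp only [Finset.sum_const, Finset.card_univ, nsmul_eq_mul]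
        ring

omit [DecidableEq ι] he in
/-- One Cauchy–Schwarz step: `(Σ_i c_i T_i)² ≤ (Σ_i c_i²)(Σ_i T_i²)`. [folklore] -/
theorem sq_sum_mul_le (c T : ι → ℝ) : (∑ i, c i * T i) ^ 2 ≤ (∑ i, c i ^ 2) * ∑ i, T i ^ 2 :=
  Finset.sum_mul_sq_le_sq_mul_sq _ c T

/-- **Norm bound ⇒ frame bound**: for `G`-unit-bounded vectors,
`|G(R(X,Y)Z, W)| ≤ √(|Rm|²_G)` (expand the four vectors in an orthonormal basis and apply the
Cauchy–Schwarz inequality). Together with `rmNormSqAt_le_of_frameBound` this is Topping's remark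
that `|Rm|` is comparable to the largest component / sectional curvature (2006, p. 37).
[cite: Topping2006, §3.2, p. 37] -/
theorem IsMetricOn.abs_apply_riem_le_sqrt (hG : IsMetricOn G V) (hx : x ∈ V) (X Y Z W : E)
    (hX : G x X X ≤ 1) (hY : G x Y Y ≤ 1) (hZ : G x Z Z ≤ 1) (hW : G x W W ≤ 1) :
    |G x (riemAt G x X Y Z) W| ≤ Real.sqrt (rmNormSqAt G x) := by
  have hs := hG.symm x hx
  -- components
  set cX : ι → ℝ := fun a ↦ G x X (e a)
  set cY : ι → ℝ := fun a ↦ G x Y (e a)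
  set cZ : ι → ℝ := fun a ↦ G x Z (e a)
  set cW : ι → ℝ := fun a ↦ G x W (e a)
  set Rc : ι → ι → ι → ι → ℝ := fun a c i j ↦ G x (riemAt G x (e a) (e c) (e i)) (e j)
  -- Parseval
  have hPX : ∑ a, cX a ^ 2 = G x X X := by
    rw [apply_eq_sum_of_orthonormal e he hs X X]; exact Finset.sum_congr rfl fun a _ ↦ by ring
  have hPY : ∑ a, cY a ^ 2 = G x Y Y := by
    rw [apply_eq_sum_of_orthonormal e he hs Y Y]; exact Finset.sum_congr rfl fun a _ ↦ by ring
  have hPZ : ∑ a, cZ a ^ 2 = G x Z Z := by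
    rw [apply_eq_sum_of_orthonormal e he hs Z Z]; exact Finset.sum_congr rfl fun a _ ↦ by ring
  have hPW : ∑ a, cW a ^ 2 = G x W W := by
    rw [apply_eq_sum_of_orthonormal e he hs W W]; exact Finset.sum_congr rfl fun a _ ↦ by ring
  -- the expansion `G(R(X,Y)Z,W) = Σ cW cZ cY cX Rc`
  have hexp : G x (riemAt G x X Y Z) W =
      ∑ j, cW j * ∑ i, cZ i * ∑ c, cY c * ∑ a, cX a * Rc a c i j := by
    conv_lhs => rw [← sum_apply_smul_of_orthonormal e he X, ← sum_apply_smul_of_orthonormal e he Y,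
      ← sum_apply_smul_of_orthonormal e he Z, ← sum_apply_smul_of_orthonormal e he W,
      ← riemCLM_apply]
    simp only [map_sum, map_smul, _root_.sum_apply, _root_.smul_apply, smul_eq_mul, riemCLM_apply,
      Finset.mul_sum]
    rfl
  -- nested Cauchy–Schwarz, innermost index first
  have hX0 : 0 ≤ ∑ a, cX a ^ 2 := Finset.sum_nonneg fun _ _ ↦ sq_nonneg _
  have hY0 : 0 ≤ ∑ a, cY a ^ 2 := Finset.sum_nonneg fun _ _ ↦ sq_nonneg _
  have hZ0 : 0 ≤ ∑ a, cZ a ^ 2 := Finset.sum_nonneg fun _ _ ↦ sq_nonneg _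
  have hW0 : 0 ≤ ∑ a, cW a ^ 2 := Finset.sum_nonneg fun _ _ ↦ sq_nonneg _
  have h3 : ∀ j i c, (∑ a, cX a * Rc a c i j) ^ 2 ≤ (∑ a, cX a ^ 2) * ∑ a, Rc a c i j ^ 2 :=
    fun j i c ↦ sq_sum_mul_le _ _
  have h2 : ∀ j i, (∑ c, cY c * ∑ a, cX a * Rc a c i j) ^ 2 ≤
      (∑ c, cY c ^ 2) * ((∑ a, cX a ^ 2) * ∑ c, ∑ a, Rc a c i j ^ 2) := fun j i ↦ by
    refine (sq_sum_mul_le _ _).trans (mul_le_mul_of_nonneg_left ?_ hY0)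
    rw [Finset.mul_sum]
    exact Finset.sum_le_sum fun c _ ↦ h3 j i c
  have h1 : ∀ j, (∑ i, cZ i * ∑ c, cY c * ∑ a, cX a * Rc a c i j) ^ 2 ≤
      (∑ i, cZ i ^ 2) * ((∑ c, cY c ^ 2) * ((∑ a, cX a ^ 2) * ∑ i, ∑ c, ∑ a, Rc a c i j ^ 2)) :=
    fun j ↦ by
    refine (sq_sum_mul_le _ _).trans (mul_le_mul_of_nonneg_left ?_ hZ0)
    rw [Finset.mul_sum, Finset.mul_sum]
    refine Finset.sum_le_sum fun i _ ↦ (h2 j i).trans (le_of_eq ?_)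
    rw [Finset.mul_sum]
  have h0 : (∑ j, cW j * ∑ i, cZ i * ∑ c, cY c * ∑ a, cX a * Rc a c i j) ^ 2 ≤
      (∑ j, cW j ^ 2) * ((∑ i, cZ i ^ 2) * ((∑ c, cY c ^ 2) * ((∑ a, cX a ^ 2) *
        ∑ j, ∑ i, ∑ c, ∑ a, Rc a c i j ^ 2))) := by
    refine (sq_sum_mul_le _ _).trans (mul_le_mul_of_nonneg_left ?_ hW0)
    rw [Finset.mul_sum, Finset.mul_sum, Finset.mul_sum]
    refine Finset.sum_le_sum fun j _ ↦ (h1 j).trans (le_of_eq ?_)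
    rw [Finset.mul_sum, Finset.mul_sum]
  -- reorder the fourfold sum of squares
  have hre : ∑ j, ∑ i, ∑ c, ∑ a, Rc a c i j ^ 2 = ∑ a, ∑ c, ∑ i, ∑ j, Rc a c i j ^ 2 := by
    calc ∑ j, ∑ i, ∑ c, ∑ a, Rc a c i j ^ 2 = ∑ j, ∑ i, ∑ a, ∑ c, Rc a c i j ^ 2 :=
          Finset.sum_congr rfl fun j _ ↦ Finset.sum_congr rfl fun i _ ↦ Finset.sum_comm
      _ = ∑ j, ∑ a, ∑ i, ∑ c, Rc a c i j ^ 2 := Finset.sum_congr rfl fun j _ ↦ Finset.sum_comm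
      _ = ∑ a, ∑ j, ∑ i, ∑ c, Rc a c i j ^ 2 := Finset.sum_comm
      _ = ∑ a, ∑ j, ∑ c, ∑ i, Rc a c i j ^ 2 :=
          Finset.sum_congr rfl fun a _ ↦ Finset.sum_congr rfl fun j _ ↦ Finset.sum_comm
      _ = ∑ a, ∑ c, ∑ j, ∑ i, Rc a c i j ^ 2 := Finset.sum_congr rfl fun a _ ↦ Finset.sum_comm
      _ = ∑ a, ∑ c, ∑ i, ∑ j, Rc a c i j ^ 2 :=
          Finset.sum_congr rfl fun a _ ↦ Finset.sum_congr rfl fun c _ ↦ Finset.sum_comm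
  refine Real.abs_le_sqrt ?_
  rw [hexp, hG.rmNormSqAt_eq_sum_sq e he hx, ← hre]
  refine h0.trans ?_
  rw [hPX, hPY, hPZ, hPW]
  set u' := ∑ j, ∑ i, ∑ c, ∑ a, Rc a c i j ^ 2 with hu'
  have hu : 0 ≤ u' := Finset.sum_nonneg fun _ _ ↦
    Finset.sum_nonneg fun _ _ ↦ Finset.sum_nonneg fun _ _ ↦ Finset.sum_nonneg fun _ _ ↦ sq_nonneg _
  have hXX : 0 ≤ G x X X := by rw [← hPX]; exact hX0
  have hYY : 0 ≤ G x Y Y := by rw [← hPY]; exact hY0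
  have hZZ : 0 ≤ G x Z Z := by rw [← hPZ]; exact hZ0
  have s4 : G x X X * u' ≤ u' := mul_le_of_le_one_left hu hX
  have s3 : G x Y Y * (G x X X * u') ≤ u' :=
    (mul_le_of_le_one_left (mul_nonneg hXX hu) hY).trans s4
  have s2 : G x Z Z * (G x Y Y * (G x X X * u')) ≤ u' :=
    (mul_le_of_le_one_left (mul_nonneg hYY (mul_nonneg hXX hu)) hZ).trans s3
  exact (mul_le_of_le_one_left (mul_nonneg hZZ (mul_nonneg hYY (mul_nonneg hXX hu))) hW).trans s2

omit [CompleteSpace E] in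
/-- **Ricci components are bounded by `n |Rm|`-type bounds**: if `|G(R(e_a,e_c)e_i,e_j)| ≤ K`
for all indices then `|Ric(e_a, e_c)| ≤ n K`. [cite: Topping2006, §3.2, p. 37] -/
theorem abs_ricAt_le {K : ℝ} (hR : ∀ a c i j, |G x (riemAt G x (e a) (e c) (e i)) (e j)| ≤ K)
    (a c : ι) : |ricAt G x (e a) (e c)| ≤ Fintype.card ι * K := by
  rw [ricAt_eq_sum_of_orthonormal e he]
  refine (Finset.abs_sum_le_sum_abs _ _).trans ?_
  calc ∑ i, |G x (riemAt G x (e i) (e a) (e c)) (e i)| ≤ ∑ _i : ι, K :=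
        Finset.sum_le_sum fun i _ ↦ hR i a c i
    _ = Fintype.card ι * K := by simp [Finset.sum_const, Finset.card_univ]

end Curvature

end MetricCoord

end Literature.Geometry.Lorentzian

end
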